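import Mathlib.NumberTheory.NumberField.Cyclotomic.PID
import Mathlib.NumberTheory.NumberField.Cyclotomic.Ideal
import Mathlib.Analysis.Real.Pi.Bounds
import Mathlib.RingTheory.ZMod
import Mathlib.Tactic.NormNum.Prime
import HarnessLib

/-!
# `ℚ(ζ₈)` and `ℚ(ζ₁₆)` have class number one: `ℤ[ζ₈]` and `ℤ[ζ₁₆]` are principal ideal domains

Topic `Literature/NumberTheory/NumberFields`, namespace `Literature.NumberTheory.NumberFields`.  Theorems only; no
definition, no named fact (net Literature debt 0).  Companion of `CyclotomicFieldFourClassNumber` (`ℚ(ζ₄)`),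
`CyclotomicFieldsSevenNineClassNumber` (`ℚ(ζ₇)`, `ℚ(ζ₉)`), `CyclotomicFieldElevenClassNumber` (`ℚ(ζ₁₁)`) and Mathlib's
`Cyclotomic/PID` (`ℚ(ζ₃)`, `ℚ(ζ₅)`): the `2`-power cyclotomic fields `ℚ(ζ₈) = ℚ(i, √2)` (`d = 2⁸ = 256`) and `ℚ(ζ₁₆)`
(`d = 2²⁴`), the remaining prime-power levels with `φ(n) ≤ 8` (Masley–Montgomery: `h(ℚ(ζ_n)) = 1` iff `φ(n) ≤ 20` or
`n ∈ {35, 45, 84}`; Washington Thm. 11.1).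

* `ℚ(ζ₈)`: `M_K = (4/π)² · (4!/4⁴) · √256 = 24/π² ≈ 2.43 < 3`; the only prime `≤ 2` is the totally ramified `2`,
  above which lies the principal prime `(ζ₈ − 1)`.
* `ℚ(ζ₁₆)`: `M_K = (4/π)⁴ · (8!/8⁸) · 2¹² ≈ 25.9 < 26`; for the odd primes `p ≤ 25` Marcus' Theorem 26 (the residue degree
  of `p` is its order modulo `16`: `4` for `p ≡ 3, 5, 11, 13`, `2` for `p ≡ 7`) gives `p^f > 25` EXCEPT for `p = 17 ≡ 1`,
  which splits completely; `2` is totally ramified (`(ζ − 1)` principal); and above `17` lies **the principal prime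
  `(1 + ζ + ζ³)` of norm `17`**, certified norm-free exactly as for `ℚ(ζ₁₁)`: the reduction `ℤ[ζ₁₆] → 𝔽₁₇`, `ζ ↦ 11`
  (`11⁸ ≡ −1 (mod 17)`; `PowerBasis.lift` on Mathlib's integral power basis) has prime kernel `(17, ζ − 11)` over `17`,
  equal to `(1 + ζ + ζ³)` by the identities in `ℤ[ζ]` (checked by `linear_combination` modulo `ζ⁸ = −1`)
  `(1 + ζ + ζ³)(7 − 4ζ − 5ζ² − 2ζ³ + 6ζ⁴ − ζ⁵ + 3ζ⁶ − 9ζ⁷) = 17`,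
  `(1 + ζ + ζ³)(−4 + 3ζ + 3ζ² + ζ³ − 4ζ⁴ + ζ⁵ − 2ζ⁶ + 6ζ⁷) = ζ − 11`.

* `discr_of_isCyclotomicExtension_eight` (`256`), `minkowskiBound_lt_three_of_isCyclotomicExtension_eight`,
  **`classNumber_eq_one_of_isCyclotomicExtension_eight`**, `isPrincipalIdealRing_adjoin_of_isPrimitiveRoot_eight`,
  `isPrincipalIdealRing_ringOfIntegers_cyclotomicField_eight`, `classNumber_cyclotomicField_eight`;
* `discr_of_isCyclotomicExtension_sixteen` (`16777216`), `minkowskiBound_lt_of_isCyclotomicExtension_sixteen` (`< 26`),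
  **`span_one_add_zeta_add_zeta_pow_three_mem_primesOver_sixteen`** (`(1 + ζ + ζ³)` is a prime above `17`),
  **`classNumber_eq_one_of_isCyclotomicExtension_sixteen`**, `isPrincipalIdealRing_adjoin_of_isPrimitiveRoot_sixteen`,
  `isPrincipalIdealRing_ringOfIntegers_cyclotomicField_sixteen`, `classNumber_cyclotomicField_sixteen`.

Consumers: the `2`-dimensional complex tori with an automorphism of order `8` (`φ(8) = 4`; generation 32 FILE 1 showed
none of them is simple) and the `4`-dimensional ones with an automorphism of order `16` (`φ(16) = 8`).

## References

* [Washington1997] L. C. Washington, *Introduction to Cyclotomic Fields*, 2nd ed., GTM 83 (1997), Thm. 11.1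
  (Masley–Montgomery), Prop. 2.1 / Lemma 1.4 (ramification of `2`), §2 (splitting of primes).
* [Marcus2018] D. A. Marcus, *Number Fields*, 2nd ed. (2018), Ch. 3 Thm. 26 (chunk p0064), Ch. 5 Thm. 37 Cor. 2
  (p0107).
* [MasleyMontgomery1976] J. M. Masley, H. L. Montgomery, *Cyclotomic fields with unique factorization*, J. reine
  angew. Math. 286/287 (1976) 248–256.
-/

noncomputable section

namespace Literature.NumberTheory.NumberFields

open NumberField NumberField.InfinitePlace Polynomial Nat Real IsCyclotomicExtension.Rat Ideal
open scoped Real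

/-! ### `ℚ(ζ₈)` -/

section Eight

variable (K : Type) [Field K] [NumberField K] [IsCyclotomicExtension {8} ℚ K]

/-- `ℚ(ζ₈)` is the `2³`-rd cyclotomic field (reindexing for Mathlib's prime-power lemmas). [folklore] -/
private theorem isCyclotomicExtension_two_pow_three : IsCyclotomicExtension {2 ^ 3} ℚ K := by
  rw [show (2 : ℕ) ^ 3 = 8 by norm_num]; infer_instance

/-- The same spelled `2 ^ (2 + 1)`. [folklore] -/
private theorem isCyclotomicExtension_two_pow_succ_two : IsCyclotomicExtension {2 ^ (2 + 1)} ℚ K := by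
  rw [show (2 : ℕ) ^ (2 + 1) = 8 by norm_num]; infer_instance

/-- **The discriminant of `ℚ(ζ₈)` is `2⁸ = 256`.** [cite: Washington1997, Prop. 2.1] -/
theorem discr_of_isCyclotomicExtension_eight : NumberField.discr K = 256 := by
  haveI := isCyclotomicExtension_two_pow_three K
  haveI : Fact (Nat.Prime 2) := ⟨Nat.prime_two⟩
  rw [discr_prime_pow 2 3 K, show (2 : ℕ) ^ 3 = 8 by norm_num, show Nat.totient 8 = 4 by decide]
  norm_num

/-- **The Minkowski constant of `ℚ(ζ₈)` is `< 3`**: `(4/π)² · (4!/4⁴) · √256 = 24/π² < (4/3)² · (3/32) · 16 < 3`.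
[cite: Marcus2018, Ch. 5 Thm. 37 Cor. 2 (p0107)] -/
theorem minkowskiBound_lt_three_of_isCyclotomicExtension_eight :
    (4 / π) ^ nrComplexPlaces K * ((Module.finrank ℚ K)! / (Module.finrank ℚ K) ^ (Module.finrank ℚ K) *
      √|(NumberField.discr K : ℝ)|) < 3 := by
  rw [discr_of_isCyclotomicExtension_eight K, IsCyclotomicExtension.finrank (n := 8) K
    (cyclotomic.irreducible_rat (by norm_num)), nrComplexPlaces_eq_totient_div_two 8, show Nat.totient 8 = 4 by decide]
  have hπ : 4 / π < 4 / 3 := by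
    apply div_lt_div_of_pos_left (by norm_num) (by norm_num) pi_gt_three
  have hπ0 : 0 ≤ 4 / π := by positivity
  have h2 : (4 / π) ^ (4 / 2) < (4 / 3 : ℝ) ^ (4 / 2) := by
    rw [show (4 / 2 : ℕ) = 2 by norm_num]
    gcongr
  have hsqrt : √|((256 : ℤ) : ℝ)| = 16 := by
    rw [show |((256 : ℤ) : ℝ)| = 16 ^ 2 by norm_num, Real.sqrt_sq (by norm_num)]
  have hfac : ((4 : ℕ)! : ℝ) / (4 : ℕ) ^ (4 : ℕ) = 3 / 32 := by
    rw [show (4 : ℕ)! = 24 by rfl]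
    norm_num
  rw [hfac, hsqrt]
  calc (4 / π) ^ (4 / 2) * (3 / 32 * (16 : ℝ))
      ≤ (4 / 3 : ℝ) ^ (4 / 2) * (3 / 32 * 16) := by gcongr
    _ < 3 := by norm_num

/-- `𝓞_K` is a principal ideal domain for an `8`-th cyclotomic extension `K/ℚ` (public form:
`classNumber_eq_one_of_isCyclotomicExtension_eight`). [cite: Washington1997, Thm. 11.1] -/
private theorem isPrincipalIdealRing_ringOfIntegers_eight_aux : IsPrincipalIdealRing (𝓞 K) := by
  haveI : Fact (Nat.Prime 2) := ⟨Nat.prime_two⟩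
  haveI : IsGalois ℚ K := IsCyclotomicExtension.isGalois {8} ℚ K
  have hM := minkowskiBound_lt_three_of_isCyclotomicExtension_eight K
  have hfloor : ⌊(4 / π) ^ nrComplexPlaces K * ((Module.finrank ℚ K)! / (Module.finrank ℚ K) ^ (Module.finrank ℚ K) *
      √|(NumberField.discr K : ℝ)|)⌋₊ ≤ 2 :=
    Nat.le_of_lt_succ ((Nat.floor_lt (by positivity)).2 hM)
  apply RingOfIntegers.isPrincipalIdealRing_of_isPrincipal_of_lt_or_isPrincipal_of_mem_primesOver_of_mem_Icc
  intro p hp hpp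
  have hp2 : p ≤ 2 := (Finset.mem_Icc.1 hp).2.trans hfloor
  have hp2' : 2 ≤ p := hpp.two_le
  interval_cases p
  -- `p = 2`: totally ramified, the prime above it is `(ζ₈ − 1)`, principal
  haveI := isCyclotomicExtension_two_pow_succ_two K
  have hζ := IsCyclotomicExtension.zeta_spec (2 ^ (2 + 1)) ℚ K
  refine ⟨Ideal.span {hζ.toInteger - 1}, ⟨inferInstance, ?_⟩, Or.inr ⟨hζ.toInteger - 1, rfl⟩⟩
  have h := liesOver_span_zeta_sub_one 2 2 hζ
  simpa using h

end Eight

/-! ### `ℚ(ζ₁₆)` -/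

section Sixteen

variable (K : Type) [Field K] [NumberField K] [IsCyclotomicExtension {16} ℚ K]

/-- `ℚ(ζ₁₆)` is the `2⁴`-th cyclotomic field. [folklore] -/
private theorem isCyclotomicExtension_two_pow_four : IsCyclotomicExtension {2 ^ 4} ℚ K := by
  rw [show (2 : ℕ) ^ 4 = 16 by norm_num]; infer_instance

/-- The same spelled `2 ^ (3 + 1)`. [folklore] -/
private theorem isCyclotomicExtension_two_pow_succ_three : IsCyclotomicExtension {2 ^ (3 + 1)} ℚ K := by
  rw [show (2 : ℕ) ^ (3 + 1) = 16 by norm_num]; infer_instance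

/-- **The discriminant of `ℚ(ζ₁₆)` is `2²⁴ = 16777216`.** [cite: Washington1997, Prop. 2.1] -/
theorem discr_of_isCyclotomicExtension_sixteen : NumberField.discr K = 16777216 := by
  haveI := isCyclotomicExtension_two_pow_four K
  haveI : Fact (Nat.Prime 2) := ⟨Nat.prime_two⟩
  rw [discr_prime_pow 2 4 K, show (2 : ℕ) ^ 4 = 16 by norm_num, show Nat.totient 16 = 8 by decide]
  norm_num

/-- **The Minkowski constant of `ℚ(ζ₁₆)` is `< 26`**: `(4/π)⁴ · (8!/8⁸) · 2¹² < (4/3.14)⁴ · (315/131072) · 4096 < 26`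
(true value `≈ 25.9`). [cite: Marcus2018, Ch. 5 Thm. 37 Cor. 2 (p0107)] -/
theorem minkowskiBound_lt_of_isCyclotomicExtension_sixteen :
    (4 / π) ^ nrComplexPlaces K * ((Module.finrank ℚ K)! / (Module.finrank ℚ K) ^ (Module.finrank ℚ K) *
      √|(NumberField.discr K : ℝ)|) < 26 := by
  rw [discr_of_isCyclotomicExtension_sixteen K, IsCyclotomicExtension.finrank (n := 16) K
    (cyclotomic.irreducible_rat (by norm_num)), nrComplexPlaces_eq_totient_div_two 16, show Nat.totient 16 = 8 by decide]
  have hπ : 4 / π < 4 / 3.14 := by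
    apply div_lt_div_of_pos_left (by norm_num) (by norm_num) pi_gt_d2
  have hπ0 : 0 ≤ 4 / π := by positivity
  have h4 : (4 / π) ^ (8 / 2) < (4 / 3.14 : ℝ) ^ (8 / 2) := by
    rw [show (8 / 2 : ℕ) = 4 by norm_num]
    gcongr
  have hsqrt : √|((16777216 : ℤ) : ℝ)| = 4096 := by
    rw [show |((16777216 : ℤ) : ℝ)| = 4096 ^ 2 by norm_num, Real.sqrt_sq (by norm_num)]
  have hfac : ((8 : ℕ)! : ℝ) / (8 : ℕ) ^ (8 : ℕ) = 315 / 131072 := by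
    rw [show (8 : ℕ)! = 40320 by rfl]
    norm_num
  rw [hfac, hsqrt]
  calc (4 / π) ^ (8 / 2) * (315 / 131072 * (4096 : ℝ))
      ≤ (4 / 3.14 : ℝ) ^ (8 / 2) * (315 / 131072 * 4096) := by gcongr
    _ < 26 := by norm_num

variable {K} in
/-- **THE PRINCIPAL PRIME `(1 + ζ + ζ³)` OF `𝓞_{ℚ(ζ₁₆)}` ABOVE `17`**: for a primitive `16`-th root of unity `ζ`, the ideal
`(1 + ζ + ζ³)` of `𝓞_K` is prime and lies over `17` — it is the kernel `(17, ζ − 11)` of the reduction `ℤ[ζ] → 𝔽₁₇`,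
`ζ ↦ 11`, by the identities `(1 + ζ + ζ³)·β = 17`, `(1 + ζ + ζ³)·γ = ζ − 11` in `ℤ[ζ]` recorded in the module docstring
(`17 ≡ 1 (mod 16)` splits completely). [cite: Marcus2018, Ch. 3 Thm. 26 (p0064) and Thm. 27] [cite: Washington1997, §2] -/
theorem span_one_add_zeta_add_zeta_pow_three_mem_primesOver_sixteen {ζ : K} (hζ : IsPrimitiveRoot ζ 16) :
    Ideal.span {1 + hζ.toInteger + hζ.toInteger ^ 3} ∈ primesOver (span {((17 : ℕ) : ℤ)}) (𝓞 K) := by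
  -- arithmetic in `𝔽₁₇`, before any local `Fact` enters the context
  have hy0 : ((Finset.range 2).sum fun i ↦ ((11 : ZMod 17) ^ 2 ^ 3) ^ i) = 0 := by decide
  have hα0 : (1 + 11 + 11 ^ 3 : ZMod 17) = 0 := by decide
  -- the reduction map `red : 𝓞 K → 𝔽₁₇`, `ζ ↦ 11`
  have hy : aeval (11 : ZMod 17) (minpoly ℤ hζ.integralPowerBasis.gen) = 0 := by
    rw [hζ.integralPowerBasis_gen, ← NumberField.RingOfIntegers.minpoly_coe]
    change aeval (11 : ZMod 17) (minpoly ℤ ζ) = 0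
    rw [← cyclotomic_eq_minpoly hζ (by norm_num), show (16 : ℕ) = 2 ^ (3 + 1) by norm_num,
      cyclotomic_prime_pow_eq_geom_sum Nat.prime_two, map_sum]
    simpa only [map_pow, aeval_X] using hy0
  set red : 𝓞 K →+* ZMod 17 := (hζ.integralPowerBasis.lift (11 : ZMod 17) hy).toRingHom with hred
  set z : 𝓞 K := hζ.toInteger with hz
  have hφz : red z = 11 := by
    rw [hred, hz, ← hζ.integralPowerBasis_gen]
    exact hζ.integralPowerBasis.lift_gen 11 hy
  -- `ζ⁸ = −1` in `𝓞 K`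
  have hΦ : z ^ 8 + 1 = 0 := by
    have h8 : IsPrimitiveRoot (z ^ 8) 2 := hζ.toInteger_isPrimitiveRoot.pow (by norm_num) (by norm_num)
    rw [h8.eq_neg_one_of_two_right, neg_add_cancel]
  -- the two certificates
  have h17 : (1 + z + z ^ 3) * (7 - 4 * z - 5 * z ^ 2 - 2 * z ^ 3 + 6 * z ^ 4 - z ^ 5 + 3 * z ^ 6 - 9 * z ^ 7) = 17 := by
    linear_combination (-10 + 3 * z - 9 * z ^ 2) * hΦ
  have h11 : (1 + z + z ^ 3) * (-4 + 3 * z + 3 * z ^ 2 + z ^ 3 - 4 * z ^ 4 + z ^ 5 - 2 * z ^ 6 + 6 * z ^ 7) = z - 11 := by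
    linear_combination (7 - 2 * z + 6 * z ^ 2) * hΦ
  -- `ker red = (1 + ζ + ζ³)`
  have hφα : red (1 + z + z ^ 3) = 0 := by
    rw [map_add, map_add, map_one, map_pow, hφz]
    exact hα0
  have hker : RingHom.ker red = Ideal.span {1 + z + z ^ 3} := by
    apply le_antisymm
    · intro x hx
      rw [RingHom.mem_ker] at hx
      obtain ⟨g, hg⟩ := hζ.integralPowerBasis.exists_eq_aeval' x
      rw [hζ.integralPowerBasis_gen, ← hz] at hg
      have hdec := modByMonic_add_div g (X - C (11 : ℤ))
      rw [modByMonic_X_sub_C_eq_C_eval] at hdec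
      have hx' : x = ((g.eval 11 : ℤ) : 𝓞 K) + (z - 11) * aeval z (g /ₘ (X - C 11)) := by
        rw [hg]
        conv_lhs => rw [← hdec]
        simp only [map_add, map_mul, map_sub, map_intCast, map_ofNat, aeval_X, eq_intCast]
      have hc : ((g.eval 11 : ℤ) : ZMod 17) = 0 := by
        have h := hx
        rw [hx', map_add, map_mul, map_sub, map_intCast, hφz, map_ofNat, sub_self, zero_mul, add_zero] at h
        exact h
      obtain ⟨m, hm⟩ := (ZMod.intCast_zmod_eq_zero_iff_dvd _ 17).1 hc
      rw [hx', hm, Int.cast_mul, Int.cast_natCast]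
      refine Ideal.add_mem _ ?_ ?_
      · rw [show ((17 : ℕ) : 𝓞 K) = 17 from rfl, ← h17, mul_assoc]
        exact Ideal.mul_mem_right _ _ (Ideal.subset_span rfl)
      · rw [← h11, mul_assoc]
        exact Ideal.mul_mem_right _ _ (Ideal.subset_span rfl)
    · rw [Ideal.span_le, Set.singleton_subset_iff]
      exact hφα
  -- conclusion
  haveI : Fact (Nat.Prime 17) := ⟨by norm_num⟩
  rw [← hker]
  refine ⟨RingHom.ker_isPrime red, ⟨?_⟩⟩
  rw [Ideal.under_def, RingHom.comap_ker, RingHom.ext_int (red.comp (algebraMap ℤ (𝓞 K))) (Int.castRingHom (ZMod 17)),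
    ZMod.ker_intCastRingHom]

/-- `𝓞_K` is a principal ideal domain for a `16`-th cyclotomic extension `K/ℚ` (public form:
`classNumber_eq_one_of_isCyclotomicExtension_sixteen`). [cite: Washington1997, Thm. 11.1] [cite: Marcus2018, Ch. 5 Thm. 37 Cor. 2 (p0107)] -/
private theorem isPrincipalIdealRing_ringOfIntegers_sixteen_aux : IsPrincipalIdealRing (𝓞 K) := by
  -- Thm. 26 data: the orders of the odd primes `≤ 25`, `≠ 17`, modulo `16`
  have o3 : orderOf (3 : ZMod 16) = 4 :=
    (orderOf_eq_iff (by norm_num)).2 ⟨by decide, fun m hm h0 ↦ by interval_cases m <;> decide⟩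
  have o5 : orderOf (5 : ZMod 16) = 4 :=
    (orderOf_eq_iff (by norm_num)).2 ⟨by decide, fun m hm h0 ↦ by interval_cases m <;> decide⟩
  have o7 : orderOf (7 : ZMod 16) = 2 :=
    (orderOf_eq_iff (by norm_num)).2 ⟨by decide, fun m hm h0 ↦ by interval_cases m; decide⟩
  have o11 : orderOf (11 : ZMod 16) = 4 :=
    (orderOf_eq_iff (by norm_num)).2 ⟨by decide, fun m hm h0 ↦ by interval_cases m <;> decide⟩
  have o13 : orderOf (13 : ZMod 16) = 4 :=
    (orderOf_eq_iff (by norm_num)).2 ⟨by decide, fun m hm h0 ↦ by interval_cases m <;> decide⟩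
  have o19 : orderOf (19 : ZMod 16) = 4 :=
    (orderOf_eq_iff (by norm_num)).2 ⟨by decide, fun m hm h0 ↦ by interval_cases m <;> decide⟩
  have o23 : orderOf (23 : ZMod 16) = 2 :=
    (orderOf_eq_iff (by norm_num)).2 ⟨by decide, fun m hm h0 ↦ by interval_cases m; decide⟩
  haveI : IsGalois ℚ K := IsCyclotomicExtension.isGalois {16} ℚ K
  have hM := minkowskiBound_lt_of_isCyclotomicExtension_sixteen K
  have hfloor : ⌊(4 / π) ^ nrComplexPlaces K * ((Module.finrank ℚ K)! / (Module.finrank ℚ K) ^ (Module.finrank ℚ K) *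
      √|(NumberField.discr K : ℝ)|)⌋₊ ≤ 25 :=
    Nat.le_of_lt_succ ((Nat.floor_lt (by positivity)).2 hM)
  -- the unramified primes: `p^f > 25` with `f` the order of `p` modulo `16`
  have key : ∀ p : ℕ, p.Prime → ¬ p ∣ 16 →
      ⌊(4 / π) ^ nrComplexPlaces K * ((Module.finrank ℚ K)! / (Module.finrank ℚ K) ^ (Module.finrank ℚ K) *
        √|(NumberField.discr K : ℝ)|)⌋₊ < p ^ orderOf (p : ZMod 16) →
      ∃ P ∈ primesOver (span {(p : ℤ)}) (𝓞 K),
        ⌊(4 / π) ^ nrComplexPlaces K * ((Module.finrank ℚ K)! / (Module.finrank ℚ K) ^ (Module.finrank ℚ K) *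
          √|(NumberField.discr K : ℝ)|)⌋₊ < p ^ P.inertiaDeg ℤ ∨ Submodule.IsPrincipal P := by
    intro p hp hdvd hlt
    haveI : Fact p.Prime := ⟨hp⟩
    obtain ⟨⟨P, hP⟩⟩ := (Ideal.span {(p : ℤ)}).nonempty_primesOver (S := 𝓞 K)
    refine ⟨P, hP, Or.inl ?_⟩
    haveI := hP.1
    haveI := hP.2
    rwa [inertiaDeg_eq_of_not_dvd p K P (m := 16) hdvd]
  apply RingOfIntegers.isPrincipalIdealRing_of_isPrincipal_of_lt_or_isPrincipal_of_mem_primesOver_of_mem_Icc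
  intro p hp hpp
  have hp25 : p ≤ 25 := (Finset.mem_Icc.1 hp).2.trans hfloor
  have hp2 : 2 ≤ p := hpp.two_le
  interval_cases p
  · -- `p = 2`: totally ramified, the prime above it is `(ζ₁₆ − 1)`, principal
    haveI : Fact (Nat.Prime 2) := ⟨Nat.prime_two⟩
    haveI := isCyclotomicExtension_two_pow_succ_three K
    have hζ := IsCyclotomicExtension.zeta_spec (2 ^ (3 + 1)) ℚ K
    refine ⟨Ideal.span {hζ.toInteger - 1}, ⟨inferInstance, ?_⟩, Or.inr ⟨hζ.toInteger - 1, rfl⟩⟩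
    have h := liesOver_span_zeta_sub_one 2 3 hζ
    simpa using h
  · exact key 3 hpp (by norm_num) (by rw [Nat.cast_ofNat, o3]; omega)
  · norm_num at hpp -- `4`
  · exact key 5 hpp (by norm_num) (by rw [Nat.cast_ofNat, o5]; omega)
  · norm_num at hpp -- `6`
  · exact key 7 hpp (by norm_num) (by rw [Nat.cast_ofNat, o7]; omega)
  · norm_num at hpp -- `8`
  · norm_num at hpp -- `9`
  · norm_num at hpp -- `10`
  · exact key 11 hpp (by norm_num) (by rw [Nat.cast_ofNat, o11]; omega)
  · norm_num at hpp -- `12`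
  · exact key 13 hpp (by norm_num) (by rw [Nat.cast_ofNat, o13]; omega)
  · norm_num at hpp -- `14`
  · norm_num at hpp -- `15`
  · norm_num at hpp -- `16`
  · -- `p = 17`: splits completely; the prime `(1 + ζ + ζ³)` above it is principal
    have hζ := IsCyclotomicExtension.zeta_spec 16 ℚ K
    exact ⟨_, span_one_add_zeta_add_zeta_pow_three_mem_primesOver_sixteen hζ, Or.inr ⟨_, rfl⟩⟩
  · norm_num at hpp -- `18`
  · exact key 19 hpp (by norm_num) (by rw [Nat.cast_ofNat, o19]; omega)
  · norm_num at hpp -- `20`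
  · norm_num at hpp -- `21`
  · norm_num at hpp -- `22`
  · exact key 23 hpp (by norm_num) (by rw [Nat.cast_ofNat, o23]; omega)
  · norm_num at hpp -- `24`
  · norm_num at hpp -- `25`

end Sixteen

/-! ### Class number one, for an arbitrary model `K`, and for Mathlib's `CyclotomicField 8 ℚ`, `CyclotomicField 16 ℚ` -/

/-- **EVERY `8`-TH CYCLOTOMIC EXTENSION `K/ℚ` HAS CLASS NUMBER ONE** (`𝓞_K = ℤ[ζ₈] = ℤ[i, √2]` is a principal ideal
domain: `M_K < 3` and the prime above the totally ramified `2` is `(ζ₈ − 1)`). [cite: Washington1997, Thm. 11.1]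
[cite: MasleyMontgomery1976, Main Theorem] -/
theorem classNumber_eq_one_of_isCyclotomicExtension_eight (K : Type) [Field K] [NumberField K]
    (hK : IsCyclotomicExtension {8} ℚ K) : classNumber K = 1 :=
  (classNumber_eq_one_iff (K := K)).2 (isPrincipalIdealRing_ringOfIntegers_eight_aux K)

/-- **`ℤ[ζ₈]` is a principal ideal domain.** [cite: Washington1997, Thm. 11.1] [cite: MasleyMontgomery1976, Main Theorem] -/
theorem isPrincipalIdealRing_adjoin_of_isPrimitiveRoot_eight {K : Type} [Field K] [NumberField K]
    [IsCyclotomicExtension {8} ℚ K] {ζ : K} (hζ : IsPrimitiveRoot ζ 8) :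
    IsPrincipalIdealRing (Algebra.adjoin ℤ ({ζ} : Set K)) :=
  haveI := isPrincipalIdealRing_ringOfIntegers_eight_aux K
  IsPrincipalIdealRing.of_surjective hζ.adjoinEquivRingOfIntegers.symm hζ.adjoinEquivRingOfIntegers.symm.surjective

/-- **EVERY `16`-TH CYCLOTOMIC EXTENSION `K/ℚ` HAS CLASS NUMBER ONE** (`𝓞_K = ℤ[ζ₁₆]` is a principal ideal domain:
`M_K < 26`, Marcus' Theorem 26 for the odd primes `≤ 25` other than `17`, the principal ramified prime `(ζ − 1)`, and the
principal prime `(1 + ζ + ζ³)` above the completely split `17`). [cite: Washington1997, Thm. 11.1] [cite: MasleyMontgomery1976, Main Theorem]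
[cite: Marcus2018, Ch. 5 Thm. 37 Cor. 2 (p0107) and Ch. 3 Thm. 26 (p0064)] -/
theorem classNumber_eq_one_of_isCyclotomicExtension_sixteen (K : Type) [Field K] [NumberField K]
    (hK : IsCyclotomicExtension {16} ℚ K) : classNumber K = 1 :=
  (classNumber_eq_one_iff (K := K)).2 (isPrincipalIdealRing_ringOfIntegers_sixteen_aux K)

/-- **`ℤ[ζ₁₆]` is a principal ideal domain.** [cite: Washington1997, Thm. 11.1] [cite: MasleyMontgomery1976, Main Theorem] -/
theorem isPrincipalIdealRing_adjoin_of_isPrimitiveRoot_sixteen {K : Type} [Field K] [NumberField K]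
    [IsCyclotomicExtension {16} ℚ K] {ζ : K} (hζ : IsPrimitiveRoot ζ 16) :
    IsPrincipalIdealRing (Algebra.adjoin ℤ ({ζ} : Set K)) :=
  haveI := isPrincipalIdealRing_ringOfIntegers_sixteen_aux K
  IsPrincipalIdealRing.of_surjective hζ.adjoinEquivRingOfIntegers.symm hζ.adjoinEquivRingOfIntegers.symm.surjective

/-- `CyclotomicField 8 ℚ` is an `8`-th cyclotomic extension of `ℚ` (Mathlib instance, as a term). [folklore] -/
private theorem isCyclotomicExtension_cyclotomicField_eight : IsCyclotomicExtension {8} ℚ (CyclotomicField 8 ℚ) :=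
  CyclotomicField.isCyclotomicExtension 8 ℚ

/-- `CyclotomicField 16 ℚ` is a `16`-th cyclotomic extension of `ℚ`. [folklore] -/
private theorem isCyclotomicExtension_cyclotomicField_sixteen :
    IsCyclotomicExtension {16} ℚ (CyclotomicField 16 ℚ) :=
  CyclotomicField.isCyclotomicExtension 16 ℚ

/-- **The ring of integers of `CyclotomicField 8 ℚ` is a principal ideal domain.** [cite: Washington1997, Thm. 11.1] -/
theorem isPrincipalIdealRing_ringOfIntegers_cyclotomicField_eight :
    IsPrincipalIdealRing (𝓞 (CyclotomicField 8 ℚ)) :=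
  haveI := isCyclotomicExtension_cyclotomicField_eight
  isPrincipalIdealRing_ringOfIntegers_eight_aux (CyclotomicField 8 ℚ)

/-- **`h(ℚ(ζ₈)) = 1`.** [cite: Washington1997, Thm. 11.1] [cite: MasleyMontgomery1976, Main Theorem] -/
theorem classNumber_cyclotomicField_eight : classNumber (CyclotomicField 8 ℚ) = 1 :=
  (classNumber_eq_one_iff (K := CyclotomicField 8 ℚ)).2 isPrincipalIdealRing_ringOfIntegers_cyclotomicField_eight

/-- **The ring of integers of `CyclotomicField 16 ℚ` is a principal ideal domain.** [cite: Washington1997, Thm. 11.1] -/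
theorem isPrincipalIdealRing_ringOfIntegers_cyclotomicField_sixteen :
    IsPrincipalIdealRing (𝓞 (CyclotomicField 16 ℚ)) :=
  haveI := isCyclotomicExtension_cyclotomicField_sixteen
  isPrincipalIdealRing_ringOfIntegers_sixteen_aux (CyclotomicField 16 ℚ)

/-- **`h(ℚ(ζ₁₆)) = 1`.** [cite: Washington1997, Thm. 11.1] [cite: MasleyMontgomery1976, Main Theorem] -/
theorem classNumber_cyclotomicField_sixteen : classNumber (CyclotomicField 16 ℚ) = 1 :=
  (classNumber_eq_one_iff (K := CyclotomicField 16 ℚ)).2 isPrincipalIdealRing_ringOfIntegers_cyclotomicField_sixteen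

end Literature.NumberTheory.NumberFields

end
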